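import Literature.MathematicalPhysics.KineticTheory.HardSphereEulerProofs
import Literature.Analysis.FunctionSpaces.TorusCalculusProofs
import Mathlib.Analysis.SpecialFunctions.SmoothTransition
import HarnessLib

/-!
# Kinetic reduction (crux `ChaosClosesEuler`, stmt-AtomisticToContinuum-15141, line `Sketch`,
# stub `stub_kineticReduction`) — helper: smooth space–time tests from the classical solution

WHAT. The in-probability inputs of the reduction (the exact weak equation of one trajectory, the clamped local
second law stmt-13352) are tested against space–time functions smooth on ALL of `ℝ × 𝕋³`, whereas the classical
Euler fields are smooth on `[0, T) × 𝕋³` only. The reduction tests with TIME-SHIFTED fields cut off in time: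
`φ(s, x) = ζ(s) · w(s + e, x)`, `ζ` a smooth plateau function built from `Real.smoothTransition`. This file provides

* `plateau` facts: the smooth plateau `ζ(s) = ST((s − a)/(b − a)) · ST((d − s)/(d − c))` (`1` on `[b, c]`, `0` off
  `(a, d)`, values in `[0, 1]`);
* `isSmoothSpaceTimeOn_univ_smul`: `ζ(s) • w(s, x)` is smooth on `ℝ × 𝕋³` when `w` is smooth on an open time
  interval `(α, β)` and `ζ` vanishes below `a > α` and above `d < β`;
* `isSmoothSpaceTimeOn_shift`: `(s, x) ↦ u(s + e, x)` is smooth on `(−e, T − e)` when `u` is smooth on `[0, T)`;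
* the time cut-off `s ↦ ST((τ₀ + Δ − s)/Δ)` of the BF18 shell: smooth, in `[0, 1]`, `= 0` for `s ≥ τ₀ + Δ`, with
  bounded first and second derivatives and Lipschitz dependence on `τ₀`.

REFERENCES. Standard calculus (smooth partitions of unity in one variable). No named fact is invoked.
-/

noncomputable section

namespace Summit.AtomisticToContinuum.HydrodynamicLimit.Theorems.ChaosClosesEulerReduction

open Set Filter Topology
open scoped ContDiff
open Literature.MathematicalPhysics.KineticTheory
open Literature.Analysis.FunctionSpaces

/-! ## §1 The smooth plateau -/

/-- The plateau `ζ(s) = ST((s − a)/(b − a)) · ST((d − s)/(d − c))` is smooth. [folklore] -/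
theorem contDiff_plateau (a b c d : ℝ) {n : ℕ∞} :
    ContDiff ℝ n fun s : ℝ => Real.smoothTransition ((s - a) / (b - a)) * Real.smoothTransition ((d - s) / (d - c)) :=
  (Real.smoothTransition.contDiff.comp ((contDiff_id.sub contDiff_const).div_const _)).mul
    (Real.smoothTransition.contDiff.comp ((contDiff_const.sub contDiff_id).div_const _))

/-- The plateau takes values in `[0, 1]`. [folklore] -/
theorem plateau_mem (a b c d s : ℝ) :
    0 ≤ Real.smoothTransition ((s - a) / (b - a)) * Real.smoothTransition ((d - s) / (d - c)) ∧
    Real.smoothTransition ((s - a) / (b - a)) * Real.smoothTransition ((d - s) / (d - c)) ≤ 1 :=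
  ⟨mul_nonneg (Real.smoothTransition.nonneg _) (Real.smoothTransition.nonneg _),
    mul_le_one₀ (Real.smoothTransition.le_one _) (Real.smoothTransition.nonneg _) (Real.smoothTransition.le_one _)⟩

/-- The plateau equals `1` on `[b, c]` (`a < b`, `c < d`). [folklore] -/
theorem plateau_eq_one {a b c d s : ℝ} (hab : a < b) (hcd : c < d) (hs : s ∈ Icc b c) :
    Real.smoothTransition ((s - a) / (b - a)) * Real.smoothTransition ((d - s) / (d - c)) = 1 := by
  rw [Real.smoothTransition.one_of_one_le, Real.smoothTransition.one_of_one_le, one_mul]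
  · rw [le_div_iff₀ (sub_pos.2 hcd)]; linarith [hs.2]
  · rw [le_div_iff₀ (sub_pos.2 hab)]; linarith [hs.1]

/-- The plateau vanishes below `a` (`a < b`). [folklore] -/
theorem plateau_eq_zero_of_le {a b c d s : ℝ} (hab : a < b) (hs : s ≤ a) :
    Real.smoothTransition ((s - a) / (b - a)) * Real.smoothTransition ((d - s) / (d - c)) = 0 := by
  rw [Real.smoothTransition.zero_of_nonpos, zero_mul]
  exact div_nonpos_of_nonpos_of_nonneg (by linarith) (by linarith)

/-- The plateau vanishes above `d` (`c < d`). [folklore] -/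
theorem plateau_eq_zero_of_ge {a b c d s : ℝ} (hcd : c < d) (hs : d ≤ s) :
    Real.smoothTransition ((s - a) / (b - a)) * Real.smoothTransition ((d - s) / (d - c)) = 0 := by
  rw [mul_comm, Real.smoothTransition.zero_of_nonpos, zero_mul]
  exact div_nonpos_of_nonpos_of_nonneg (by linarith) (by linarith)

/-! ## §2 Smoothness on all of space–time of cut-off fields -/

/-- **A cut-off field is smooth on all of `ℝ × 𝕋³`.** If `w` is smooth on the open time interval `(α, β)` and the
smooth scalar `ζ` vanishes on `(−∞, a]` and on `[d, ∞)` with `α < a`, `d < β`, then `(s, x) ↦ ζ(s) • w(s, x)` is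
smooth on `ℝ × 𝕋³` (locality of smoothness: near a time of `(α, β)` it is a product of smooth functions, near any
other time it vanishes identically). [folklore] -/
theorem isSmoothSpaceTimeOn_univ_smul {F : Type*} [NormedAddCommGroup F] [NormedSpace ℝ F]
    {w : ℝ → T3 → F} {α β a d : ℝ} (hw : Torus.IsSmoothSpaceTimeOn (Ioo α β) w)
    {ζ : ℝ → ℝ} (hζ : ContDiff ℝ ∞ ζ) (hαa : α < a) (hdβ : d < β)
    (hζa : ∀ s, s ≤ a → ζ s = 0) (hζd : ∀ s, d ≤ s → ζ s = 0) :
    Torus.IsSmoothSpaceTimeOn Set.univ fun s x => ζ s • w s x := by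
  have hlift : Torus.stLift (fun s x => ζ s • w s x) = fun p : ℝ × V3 => ζ p.1 • Torus.stLift w p := by
    funext p; rfl
  unfold Torus.IsSmoothSpaceTimeOn
  rw [hlift, Set.univ_prod_univ, contDiffOn_univ]
  refine contDiff_iff_contDiffAt.2 fun p => ?_
  by_cases hp : p.1 ∈ Ioo α β
  · -- inside the time interval: a product of smooth functions
    have hopen : IsOpen (Ioo α β ×ˢ (Set.univ : Set V3)) := isOpen_Ioo.prod isOpen_univ
    have hmem : Ioo α β ×ˢ (Set.univ : Set V3) ∈ 𝓝 p := hopen.mem_nhds ⟨hp, Set.mem_univ _⟩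
    have h1 : ContDiffAt ℝ ∞ (Torus.stLift w) p := hw.contDiffAt hmem
    exact ((hζ.comp contDiff_fst).contDiffAt).smul h1
  · -- outside: the field vanishes near `p`
    have hzero : (fun q : ℝ × V3 => ζ q.1 • Torus.stLift w q) =ᶠ[𝓝 p] fun _ => 0 := by
      rcases not_and_or.1 hp with h | h
      · have hlt : p.1 < a := lt_of_le_of_lt (not_lt.1 h) hαa
        have hev : ∀ᶠ q in 𝓝 p, q.1 < a := (continuous_fst.tendsto p).eventually (Iio_mem_nhds hlt)
        filter_upwards [hev] with q hq
        rw [hζa q.1 hq.le, zero_smul]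
      · have hgt : d < p.1 := lt_of_lt_of_le hdβ (not_lt.1 h)
        have hev : ∀ᶠ q in 𝓝 p, d < q.1 := (continuous_fst.tendsto p).eventually (Ioi_mem_nhds hgt)
        filter_upwards [hev] with q hq
        rw [hζd q.1 hq.le, zero_smul]
    exact (contDiffAt_const (c := (0 : F))).congr_of_eventuallyEq hzero

/-- Scalar form of `isSmoothSpaceTimeOn_univ_smul`: `(s, x) ↦ ζ(s) w(s, x)`. [folklore] -/
theorem isSmoothSpaceTimeOn_univ_mul {w : ℝ → T3 → ℝ} {α β a d : ℝ} (hw : Torus.IsSmoothSpaceTimeOn (Ioo α β) w)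
    {ζ : ℝ → ℝ} (hζ : ContDiff ℝ ∞ ζ) (hαa : α < a) (hdβ : d < β)
    (hζa : ∀ s, s ≤ a → ζ s = 0) (hζd : ∀ s, d ≤ s → ζ s = 0) :
    Torus.IsSmoothSpaceTimeOn Set.univ fun s x => ζ s * w s x :=
  isSmoothSpaceTimeOn_univ_smul hw hζ hαa hdβ hζa hζd

/-- **Time shifts of the classical fields.** If `u` is smooth on `[0, T) × 𝕋³` then `(s, x) ↦ u(s + e, x)` is
smooth on the open time interval `(−e, T − e)`. [folklore] -/
theorem isSmoothSpaceTimeOn_shift {F : Type*} [NormedAddCommGroup F] [NormedSpace ℝ F] {T : ℝ}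
    {u : ℝ → T3 → F} (hu : Torus.IsSmoothSpaceTimeOn (Ico 0 T) u) (e : ℝ) :
    Torus.IsSmoothSpaceTimeOn (Ioo (-e) (T - e)) fun s x => u (s + e) x := by
  have hlift : Torus.stLift (fun s x => u (s + e) x) = Torus.stLift u ∘ fun p : ℝ × V3 => (p.1 + e, p.2) := by
    funext p; rfl
  unfold Torus.IsSmoothSpaceTimeOn
  rw [hlift]
  refine hu.comp ((contDiff_fst.add contDiff_const).prodMk contDiff_snd).contDiffOn fun p hp => ?_
  refine ⟨⟨by linarith [hp.1.1], by linarith [hp.1.2]⟩, Set.mem_univ _⟩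

/-- Smoothness on `[0, T)` restricts to the open interval `(0, T)`. [folklore] -/
theorem isSmoothSpaceTimeOn_Ioo_of_Ico {F : Type*} [NormedAddCommGroup F] [NormedSpace ℝ F] {T : ℝ}
    {u : ℝ → T3 → F} (hu : Torus.IsSmoothSpaceTimeOn (Ico 0 T) u) :
    Torus.IsSmoothSpaceTimeOn (Ioo 0 T) u :=
  hu.mono (Set.prod_mono Set.Ioo_subset_Ico_self subset_rfl)

/-! ## §3 Derivatives of the cut-off, shifted tests on the plateau -/

/-- In the interior `(0, T)` the one-sided time derivative within `[0, T)` is the two-sided one. [folklore] -/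
theorem timeDerivWithin_Ico_eq_timeDeriv {F : Type*} [NormedAddCommGroup F] [NormedSpace ℝ F] {T : ℝ}
    (u : ℝ → T3 → F) {s : ℝ} (hs : s ∈ Ioo 0 T) (x : T3) :
    Torus.timeDerivWithin (Ico 0 T) u s x = Torus.timeDeriv u s x := by
  refine Torus.timeDerivWithin_of_mem_interior ?_ x
  rw [interior_Ico]
  exact hs

/-- The two-sided time derivative of the shifted field is the shifted one-sided derivative (interior times).
[folklore] -/
theorem timeDeriv_shift {F : Type*} [NormedAddCommGroup F] [NormedSpace ℝ F] {T : ℝ} (u : ℝ → T3 → F)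
    (e : ℝ) {s : ℝ} (hs : s + e ∈ Ioo 0 T) (x : T3) :
    Torus.timeDeriv (fun s' y => u (s' + e) y) s x = Torus.timeDerivWithin (Ico 0 T) u (s + e) x := by
  rw [timeDerivWithin_Ico_eq_timeDeriv u hs x]
  unfold Torus.timeDeriv
  exact deriv_comp_add_const (fun τ => u τ x) e s

/-- **On the plateau the cut-off shifted test is the shifted field**, as a time slice. [folklore] -/
theorem slice_eq_of_plateau {F : Type*} [NormedAddCommGroup F] [NormedSpace ℝ F] {w : ℝ → T3 → F} {ζ : ℝ → ℝ}
    {s : ℝ} (hζ : ζ s = 1) : (fun x => ζ s • w s x) = w s := by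
  funext x; rw [hζ, one_smul]

/-- **Time derivative on the plateau.** If `ζ = 1` on a neighbourhood of `s`, the two-sided time derivative of
`ζ(s) • w(s, x)` at `s` is that of `w`. [folklore] -/
theorem timeDeriv_smul_of_eventually_one {F : Type*} [NormedAddCommGroup F] [NormedSpace ℝ F]
    {w : ℝ → T3 → F} {ζ : ℝ → ℝ} {s : ℝ} (hζ : ∀ᶠ s' in 𝓝 s, ζ s' = 1) (x : T3) :
    Torus.timeDeriv (fun s' y => ζ s' • w s' y) s x = Torus.timeDeriv w s x := by
  unfold Torus.timeDeriv
  refine Filter.EventuallyEq.deriv_eq ?_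
  filter_upwards [hζ] with s' hs'
  rw [hs', one_smul]

/-- The plateau equals `1` near every point of the open interval `(b, c)` on which it is `1`. [folklore] -/
theorem eventually_plateau_eq_one {a b c d s : ℝ} (hab : a < b) (hcd : c < d) (hs : s ∈ Ioo b c) :
    ∀ᶠ s' in 𝓝 s, Real.smoothTransition ((s' - a) / (b - a)) * Real.smoothTransition ((d - s') / (d - c)) = 1 := by
  filter_upwards [Ioo_mem_nhds hs.1 hs.2] with s' hs'
  exact plateau_eq_one hab hcd ⟨hs'.1.le, hs'.2.le⟩

/-! ## §4 The time cut-off of the BF18 shell -/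

/-- The shell's time cut-off `s ↦ ST((τ₀ + Δ − s)/Δ)` is smooth. [folklore] -/
theorem contDiff_cut (τ₀ Δ : ℝ) {n : ℕ∞} : ContDiff ℝ n fun s : ℝ => Real.smoothTransition ((τ₀ + Δ - s) / Δ) :=
  Real.smoothTransition.contDiff.comp ((contDiff_const.sub contDiff_id).div_const _)

/-- The time cut-off takes values in `[0, 1]`. [folklore] -/
theorem cut_mem (τ₀ Δ s : ℝ) : 0 ≤ Real.smoothTransition ((τ₀ + Δ - s) / Δ) ∧ Real.smoothTransition ((τ₀ + Δ - s) / Δ) ≤ 1 :=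
  ⟨Real.smoothTransition.nonneg _, Real.smoothTransition.le_one _⟩

/-- **Registered sub-goal `stub_reductionSmooth` (helper of `stub_kineticReduction`): the shell's time cut-off
vanishes for `s ≥ τ₀ + Δ`** (`Δ > 0`), so the entropy tests of the reduction vanish after `τ₀ + Δ < τ` as the clamped
local second law (stmt-13352) requires. [folklore] -/
theorem stub_reductionSmooth : ∀ {τ₀ Δ s : ℝ}, 0 < Δ → τ₀ + Δ ≤ s → Real.smoothTransition ((τ₀ + Δ - s) / Δ) = 0 := by
  intro τ₀ Δ s hΔ hs
  exact Real.smoothTransition.zero_of_nonpos (div_nonpos_of_nonpos_of_nonneg (by linarith) hΔ.le)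

/-- The time cut-off vanishes for `s ≥ τ₀ + Δ` (`Δ > 0`). [folklore] -/
theorem cut_eq_zero {τ₀ Δ s : ℝ} (hΔ : 0 < Δ) (hs : τ₀ + Δ ≤ s) : Real.smoothTransition ((τ₀ + Δ - s) / Δ) = 0 :=
  stub_reductionSmooth hΔ hs

/-- The time cut-off equals `1` for `s ≤ τ₀` (`Δ > 0`). [folklore] -/
theorem cut_eq_one {τ₀ Δ s : ℝ} (hΔ : 0 < Δ) (hs : s ≤ τ₀) : Real.smoothTransition ((τ₀ + Δ - s) / Δ) = 1 :=
  Real.smoothTransition.one_of_one_le (by rw [le_div_iff₀ hΔ]; linarith)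

/-- **The derivatives of `Real.smoothTransition` are bounded**: there is `C ≥ 0` with `|ST'| ≤ C` and `|ST''| ≤ C`
on `ℝ` (both vanish off `[0, 1]`, where `ST` is constant; on `[0, 1]` they are continuous). [folklore] -/
theorem exists_bound_deriv_smoothTransition :
    ∃ C : ℝ, 0 ≤ C ∧ (∀ x, |deriv Real.smoothTransition x| ≤ C) ∧
      ∀ x, |deriv (deriv Real.smoothTransition) x| ≤ C := by
  have hinf : ContDiff ℝ ∞ Real.smoothTransition := Real.smoothTransition.contDiff
  have hd1 : Continuous (deriv Real.smoothTransition) := by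
    change Continuous (deriv^[1] Real.smoothTransition)
    exact (hinf.iterate_deriv 1).continuous
  have hd2 : Continuous (deriv (deriv Real.smoothTransition)) := by
    change Continuous (deriv^[2] Real.smoothTransition)
    exact (hinf.iterate_deriv 2).continuous
  -- off `[0, 1]` the function is locally constant, so both derivatives vanish there
  have hconst_hi : ∀ x, 1 < x → deriv Real.smoothTransition =ᶠ[𝓝 x] fun _ => 0 := by
    intro x hx
    have hev : ∀ᶠ y in 𝓝 x, Real.smoothTransition y = 1 := by
      filter_upwards [Ioi_mem_nhds hx] with y hy using Real.smoothTransition.one_of_one_le hy.le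
    have hev' : ∀ᶠ y in 𝓝 x, ∀ᶠ z in 𝓝 y, Real.smoothTransition z = 1 := by
      filter_upwards [eventually_eventually_nhds.2 hev] with y hy using hy
    filter_upwards [hev'] with y hy
    rw [Filter.EventuallyEq.deriv_eq (hy.mono fun z hz => by rw [hz]), deriv_const]
  have hconst_lo : ∀ x, x < 0 → deriv Real.smoothTransition =ᶠ[𝓝 x] fun _ => 0 := by
    intro x hx
    have hev : ∀ᶠ y in 𝓝 x, Real.smoothTransition y = 0 := by
      filter_upwards [Iio_mem_nhds hx] with y hy using Real.smoothTransition.zero_of_nonpos hy.le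
    have hev' : ∀ᶠ y in 𝓝 x, ∀ᶠ z in 𝓝 y, Real.smoothTransition z = 0 := by
      filter_upwards [eventually_eventually_nhds.2 hev] with y hy using hy
    filter_upwards [hev'] with y hy
    rw [Filter.EventuallyEq.deriv_eq (hy.mono fun z hz => by rw [hz]), deriv_const]
  have hzero1 : ∀ x, x ∉ Icc (0 : ℝ) 1 → deriv Real.smoothTransition x = 0 := by
    intro x hx
    rcases not_and_or.1 hx with h | h
    · exact (hconst_lo x (not_le.1 h)).eq_of_nhds
    · exact (hconst_hi x (not_le.1 h)).eq_of_nhds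
  have hzero2 : ∀ x, x ∉ Icc (0 : ℝ) 1 → deriv (deriv Real.smoothTransition) x = 0 := by
    intro x hx
    rcases not_and_or.1 hx with h | h
    · rw [Filter.EventuallyEq.deriv_eq (hconst_lo x (not_le.1 h)), deriv_const]
    · rw [Filter.EventuallyEq.deriv_eq (hconst_hi x (not_le.1 h)), deriv_const]
  obtain ⟨C1, hC1⟩ := (isCompact_Icc : IsCompact (Icc (0 : ℝ) 1)).exists_bound_of_continuousOn hd1.continuousOn
  obtain ⟨C2, hC2⟩ := (isCompact_Icc : IsCompact (Icc (0 : ℝ) 1)).exists_bound_of_continuousOn hd2.continuousOn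
  refine ⟨max (max C1 C2) 0, le_max_right _ _, fun x => ?_, fun x => ?_⟩
  · by_cases hx : x ∈ Icc (0 : ℝ) 1
    · rw [← Real.norm_eq_abs]
      exact (hC1 x hx).trans ((le_max_left _ _).trans (le_max_left _ _))
    · rw [hzero1 x hx, abs_zero]; exact le_max_right _ _
  · by_cases hx : x ∈ Icc (0 : ℝ) 1
    · rw [← Real.norm_eq_abs]
      exact (hC2 x hx).trans ((le_max_right _ _).trans (le_max_left _ _))
    · rw [hzero2 x hx, abs_zero]; exact le_max_right _ _

/-- The derivative of the time cut-off in `s`: `d/ds ST((τ₀ + Δ − s)/Δ) = −Δ⁻¹ ST'((τ₀ + Δ − s)/Δ)`. [folklore] -/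
theorem hasDerivAt_cut (τ₀ Δ s : ℝ) :
    HasDerivAt (fun s : ℝ => Real.smoothTransition ((τ₀ + Δ - s) / Δ))
      (deriv Real.smoothTransition ((τ₀ + Δ - s) / Δ) * (-Δ⁻¹)) s := by
  have h1 : HasDerivAt (fun s : ℝ => (τ₀ + Δ - s) / Δ) (-Δ⁻¹) s :=
    (((hasDerivAt_const s (τ₀ + Δ)).sub (hasDerivAt_id' s)).div_const Δ).congr_deriv (by ring)
  have hd : HasDerivAt Real.smoothTransition (deriv Real.smoothTransition ((τ₀ + Δ - s) / Δ)) ((τ₀ + Δ - s) / Δ) :=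
    (Real.smoothTransition.contDiff.differentiable (by simp : ((1 : ℕ∞) : WithTop ℕ∞) ≠ 0)).differentiableAt.hasDerivAt
  exact hd.comp s h1

/-- The derivative of the time cut-off in `τ₀`: `d/dτ₀ ST((τ₀ + Δ − s)/Δ) = Δ⁻¹ ST'((τ₀ + Δ − s)/Δ)`. [folklore] -/
theorem hasDerivAt_cut_base (Δ s τ₀ : ℝ) :
    HasDerivAt (fun τ₀ : ℝ => Real.smoothTransition ((τ₀ + Δ - s) / Δ))
      (deriv Real.smoothTransition ((τ₀ + Δ - s) / Δ) * Δ⁻¹) τ₀ := by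
  have h1 : HasDerivAt (fun τ₀ : ℝ => (τ₀ + Δ - s) / Δ) Δ⁻¹ τ₀ :=
    ((((hasDerivAt_id' τ₀).add_const Δ).sub_const s).div_const Δ).congr_deriv (by ring)
  have hd : HasDerivAt Real.smoothTransition (deriv Real.smoothTransition ((τ₀ + Δ - s) / Δ)) ((τ₀ + Δ - s) / Δ) :=
    (Real.smoothTransition.contDiff.differentiable (by simp : ((1 : ℕ∞) : WithTop ℕ∞) ≠ 0)).differentiableAt.hasDerivAt
  exact hd.comp τ₀ h1

/-- **Lipschitz dependence of the cut-off on its base time**: `|ST((τ₀+Δ−s)/Δ) − ST((τ₀'+Δ−s)/Δ)| ≤ (C/Δ)|τ₀ − τ₀'|`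
for a bound `C` of `|ST'|` (`Δ > 0`). [folklore] -/
theorem abs_cut_sub_cut_le {C : ℝ} (hC : ∀ x, |deriv Real.smoothTransition x| ≤ C) {Δ : ℝ} (hΔ : 0 < Δ)
    (s τ₀ τ₀' : ℝ) :
    |Real.smoothTransition ((τ₀ + Δ - s) / Δ) - Real.smoothTransition ((τ₀' + Δ - s) / Δ)| ≤ C / Δ * |τ₀ - τ₀'| := by
  have hC0 : 0 ≤ C := (abs_nonneg _).trans (hC 0)
  have hderiv : ∀ τ, HasDerivAt (fun τ₀ : ℝ => Real.smoothTransition ((τ₀ + Δ - s) / Δ))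
      (deriv Real.smoothTransition ((τ + Δ - s) / Δ) * Δ⁻¹) τ := fun τ => hasDerivAt_cut_base Δ s τ
  have hbound : ∀ τ, ‖deriv Real.smoothTransition ((τ + Δ - s) / Δ) * Δ⁻¹‖ ≤ C / Δ := by
    intro τ
    rw [Real.norm_eq_abs, abs_mul, abs_of_pos (inv_pos.2 hΔ), div_eq_mul_inv]
    exact mul_le_mul_of_nonneg_right (hC _) (inv_nonneg.2 hΔ.le)
  have h := Convex.norm_image_sub_le_of_norm_hasDerivWithin_le (s := Set.univ)
    (fun τ _ => (hderiv τ).hasDerivWithinAt) (fun τ _ => hbound τ) convex_univ (Set.mem_univ τ₀') (Set.mem_univ τ₀)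
  rw [Real.norm_eq_abs, Real.norm_eq_abs] at h
  exact h

/-- **Lipschitz dependence of the `s`-derivative of the cut-off on its base time**:
`|d/ds ST((τ₀+Δ−s)/Δ) − d/ds ST((τ₀'+Δ−s)/Δ)| ≤ (C/Δ²)|τ₀ − τ₀'|` for a bound `C` of `|ST''|`. [folklore] -/
theorem abs_dcut_sub_dcut_le {C : ℝ} (hC : ∀ x, |deriv (deriv Real.smoothTransition) x| ≤ C) {Δ : ℝ} (hΔ : 0 < Δ)
    (s τ₀ τ₀' : ℝ) :
    |deriv Real.smoothTransition ((τ₀ + Δ - s) / Δ) * (-Δ⁻¹) -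
      deriv Real.smoothTransition ((τ₀' + Δ - s) / Δ) * (-Δ⁻¹)| ≤ C / Δ ^ 2 * |τ₀ - τ₀'| := by
  have hC0 : 0 ≤ C := (abs_nonneg _).trans (hC 0)
  have hd2 : ∀ y, HasDerivAt (deriv Real.smoothTransition) (deriv (deriv Real.smoothTransition) y) y := fun y => by
    have hinf : ContDiff ℝ ∞ Real.smoothTransition := Real.smoothTransition.contDiff
    have hdiff : Differentiable ℝ (deriv Real.smoothTransition) := by
      change Differentiable ℝ (deriv^[1] Real.smoothTransition)
      exact (hinf.iterate_deriv 1).differentiable (by simp)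
    exact (hdiff y).hasDerivAt
  have hderiv : ∀ τ, HasDerivAt (fun τ₀ : ℝ => deriv Real.smoothTransition ((τ₀ + Δ - s) / Δ) * (-Δ⁻¹))
      (deriv (deriv Real.smoothTransition) ((τ + Δ - s) / Δ) * Δ⁻¹ * (-Δ⁻¹)) τ := by
    intro τ
    have h1 : HasDerivAt (fun τ₀ : ℝ => (τ₀ + Δ - s) / Δ) Δ⁻¹ τ :=
      ((((hasDerivAt_id' τ).add_const Δ).sub_const s).div_const Δ).congr_deriv (by ring)
    exact ((hd2 _).comp τ h1).mul_const _
  have hbound : ∀ τ, ‖deriv (deriv Real.smoothTransition) ((τ + Δ - s) / Δ) * Δ⁻¹ * (-Δ⁻¹)‖ ≤ C / Δ ^ 2 := by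
    intro τ
    rw [Real.norm_eq_abs, abs_mul, abs_mul, abs_neg, abs_of_pos (inv_pos.2 hΔ)]
    have : C / Δ ^ 2 = C * Δ⁻¹ * Δ⁻¹ := by field_simp
    rw [this]
    gcongr
    exact hC _
  have h := Convex.norm_image_sub_le_of_norm_hasDerivWithin_le (s := Set.univ)
    (fun τ _ => (hderiv τ).hasDerivWithinAt) (fun τ _ => hbound τ) convex_univ (Set.mem_univ τ₀') (Set.mem_univ τ₀)
  rw [Real.norm_eq_abs, Real.norm_eq_abs] at h
  exact h

/-- The `s`-derivative of the cut-off is bounded by `C/Δ` for a bound `C` of `|ST'|` (`Δ > 0`). [folklore] -/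
theorem abs_dcut_le {C : ℝ} (hC : ∀ x, |deriv Real.smoothTransition x| ≤ C) {Δ : ℝ} (hΔ : 0 < Δ) (τ₀ s : ℝ) :
    |deriv Real.smoothTransition ((τ₀ + Δ - s) / Δ) * (-Δ⁻¹)| ≤ C / Δ := by
  rw [abs_mul, abs_neg, abs_of_pos (inv_pos.2 hΔ), div_eq_mul_inv]
  exact mul_le_mul_of_nonneg_right (hC _) (inv_nonneg.2 hΔ.le)

end Summit.AtomisticToContinuum.HydrodynamicLimit.Theorems.ChaosClosesEulerReduction

end
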